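import Summits.HodgeConjecture.HodgeConjecture.Theorems.MarkmanPartnerTransportPicardThreeK3SquaresQuotientSimilitude
import Summits.HodgeConjecture.HodgeConjecture.Theorems.MarkmanPartnerTransportPicardThreeK3SquaresSqrtSix

/-!
# Route MarkmanPartnerTransport · crux `PicardThreeK3Squares` (stmt-HodgeConjecture-19652) —
# the `√2`- and `√3`-sectors RE-BASED on Buskin + Varesco's quotient similitudes alone

With the kernel theorem `QuotientSimilitude.cycleInduced_of_algebraicSimilitude` (Varesco's Thm. 2.1
proof in the tree, `…QuotientSimilitude`), the two printed real-multiplication sectors of the crux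
follow from the named facts `Varesco2023_quotientSimilitude_two/three_of_transcendental_embedding`
(§2 "starting observation" ∘ Prop. 2.5 / 2.11: an ALGEBRAIC similitude of multiplier `p` onto `T(X)`
from another marked K3 surface, for `X` with `T(X)_ℚ ↪ Γ_p ⊗ ℚ`) and `Buskin2019_hodgeIsometry_algebraic`
— WITHOUT `Huybrechts_K3_periodSurjective_projective`, `VanGeemenSarti2007_nikulinInvolution_of_primitiveE8`,
`Varesco2023_sqrtMultiplication_algebraic_of_symplecticAutomorphism` (the inputs of the tree's
`NikulinIsogeny.hodgeConjectureFor_square_of_eleven/twelve_le_of_sqrtTwo`) and WITHOUT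
`Varesco2023_sqrtThree_algebraic_of_transcendental_embedding` (the input of
`SymplecticLocus.hodgeConjectureFor_square_of_fifteen_le_of_sqrtThree`). So the whole real-multiplication
edifice of the crux at `ρ ≥ 11` (`√2`, `√3`, `√6`) rests on three geometric inputs: Buskin's theorem and
Varesco's two quotient similitudes (plus `Huybrechts_K3_marking_exists` for marking-free corollaries and
the CM branch).

* `sqrtTwo_cycleInduced_of_embedding` / `sqrtThree_cycleInduced_of_embedding` — `√2` (resp. `√3`) on
  `T(X)` is cycle-induced for every marked projective K3 surface with `T(X)_ℚ ↪ (U³ ⊕ E₈(−2)) ⊗ ℚ`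
  (resp. `↪ (U³ ⊕ A₂²) ⊗ ℚ`), any Picard rank.
* `sqrtTwo_cycleInduced_of_eleven_le` (`ρ ≥ 11`) / `sqrtThree_cycleInduced_of_fifteen_le` (`ρ ≥ 15`) —
  the lattice criteria are automatic there (Kitaoka, `exists_transcendentalEmbedding_weightedSumSquares`).
* `hodgeConjectureFor_square_of_eleven_le_of_sqrtTwoSector` — HC⁴(S ⊗ S) at `ρ ≥ 11` from the
  `√2`-sector data, mod {Buskin, quotient₂}; `hodgeConjectureFor_square_of_twelve_le_of_sqrtTwo` (+ `'`
  marking-free) — at `ρ ≥ 12` from a `√2`-similitude alone (sector clause automatic or CM), mod {Buskin,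
  quotient₂, markings}: EVERY projective K3 surface of Picard rank `12, 14, 16` with real multiplication
  by `ℚ(√2)`.
* `hodgeConjectureFor_square_of_twelve_le_of_sqrtThree_of_embedding`,
  `hodgeConjectureFor_square_of_fifteen_le_of_sqrtThree` (+ `'`) — the `√3`-sector, mod {Buskin,
  quotient₃, markings}.

No definition, no sorry. Prover seat hodge-nonav-19652-p1 (gen 5), `--supports stmt-HodgeConjecture-19652`.

References: Varesco, Math. Z. 305 (2023) §2; van Geemen, Michigan Math. J. 56 (2008) Lemma 3.2;
Buskin, J. reine angew. Math. 755 (2019); Kitaoka, *Arithmetic of quadratic forms*, Cor. 4.1.4.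
-/

set_option linter.dupNamespace false

noncomputable section

namespace Summit.HodgeConjecture.HodgeConjecture.Theorems.MarkmanPartnerTransport.QuotientSimilitude

open scoped Manifold
open Module CategoryTheory MonoidalCategory CartesianMonoidalCategory
open Literature.AlgebraicGeometry Literature.AlgebraicGeometry.Motives Literature.AlgebraicGeometry.HodgeTheory
open Literature.AlgebraicGeometry.Surfaces
open Literature.AlgebraicTopology.SingularHomology
open Summit.HodgeConjecture.HodgeConjecture.Theorems
open Summit.HodgeConjecture.HodgeConjecture.Theorems.NikulinTwinTransport
open Summit.HodgeConjecture.HodgeConjecture.Theorems.NikulinTwinTransport.SquareGlueFree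
open Summit.HodgeConjecture.HodgeConjecture.Theorems.MarkmanPartnerTransport

variable {S : SchemeOver ℂ}

/-- `MarkedK3[S, η, p, x]`: VERBATIM the `let MarkedK3 := …` binder of the route declaration
`PicardThreeK3Squares`. Local notation only. -/
local notation3 (prettyPrint := false) "MarkedK3[" S ", " η ", " p ", " x "]" =>
  (p ≠ 0 ∧ (IsIntegralClass p ∧
    (∀ q : complexBetti S (2 * 2), IsIntegralClass q → ∃ n : ℤ, q = n • p) ∧
    (∀ c : complexBetti S (2 * 1), IsIntegralClass c ↔ ∃ v : K3Index → ℤ, η c = fun i => (v i : ℂ)) ∧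
    (∀ a b : complexBetti S (2 * 1),
      cupProduct (rfl : 2 * 1 + 2 * 1 = 2 * 2) a b = k3Form (η a) (η b) • p) ∧
    IsOfHodgeType 2 S (2 * 1) 2 0 (LinearEquiv.symm η x) ∧
    (∀ τ : complexBetti S (2 * 1), IsOfHodgeType 2 S (2 * 1) 2 0 τ →
      ∃ t : ℂ, τ = t • LinearEquiv.symm η x)) ∧
    (k3Form x x = 0 ∧ 0 < (k3Form (star x) x).re ∧
      ∃ u : K3Index → ℤ, k3Form (fun i => (u i : ℂ)) x = 0 ∧ 0 < ∑ i, ∑ j, u i * k3Gram i j * u j))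

/-- `Corr[μ, X, Y, hX, hY ; γ, y] = fst_* (snd^* y ∪ γ)` (`hX hY : IsSmoothProjective 2 _`). Local notation only. -/
local notation3 (prettyPrint := false) "Corr[" μ ", " X ", " Y ", " hX ", " hY " ; " γ ", " y "]" =>
  complexGysin μ (IsSmoothProjective.tensor_holds hX hY) hX (SemiCartesianMonoidalCategory.fst X Y)
    (rfl : 2 * 1 + 2 * 2 + 2 * 2 = 2 * 1 + 2 * (2 + 2))
    (cupProduct (rfl : 2 * 1 + 2 * 2 = 2 * 1 + 2 * 2)
      (complexBetti.map (SemiCartesianMonoidalCategory.snd X Y) (2 * 1) y) γ)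

/-- `SqrtSector[S, ψ, q]`: the `√q`-sector data, VERBATIM as in `…SqrtNatSector`. Local notation only. -/
local notation3 (prettyPrint := false) "SqrtSector[" S ", " ψ ", " q "]" =>
  (Set.MapsTo ψ (transcendentalSubspace S) (transcendentalSubspace S) ∧
    (∀ x ∈ transcendentalSubspace S, IsRationalClass x → IsRationalClass (ψ x)) ∧
    (∀ (i j : ℕ), ∀ x ∈ transcendentalSubspace S,
      IsOfHodgeType 2 S (2 * 1) i j x → IsOfHodgeType 2 S (2 * 1) i j (ψ x)) ∧
    (∀ x ∈ transcendentalSubspace S, ψ (ψ x) = ((q : ℕ) : ℂ) • x) ∧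
    (∀ x ∈ transcendentalSubspace S, ∀ y ∈ transcendentalSubspace S,
      cupProduct (rfl : 2 * 1 + 2 * 1 = 2 * 2) (ψ x) (ψ y) =
        ((q : ℕ) : ℂ) • cupProduct (rfl : 2 * 1 + 2 * 1 = 2 * 2) x y) ∧
    (∀ (f : complexBetti S (2 * 1) →ₗ[ℂ] complexBetti S (2 * 1)),
      (∀ y, IsRationalClass y → IsRationalClass (f y)) →
      (∀ (i j : ℕ) y, IsOfHodgeType 2 S (2 * 1) i j y → IsOfHodgeType 2 S (2 * 1) i j (f y)) →
      (∀ d ∈ algebraicClasses S 1, f d = 0) →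
      (∀ y : complexBetti S (2 * 1), ∀ d ∈ algebraicClasses S 1,
        cupProduct (rfl : 2 * 1 + 2 * 1 = 2 * 2) (f y) d = 0) →
      ∃ a b : ℚ, ∀ y : complexBetti S (2 * 1),
        (∀ d ∈ algebraicClasses S 1, cupProduct (rfl : 2 * 1 + 2 * 1 = 2 * 2) y d = 0) →
        f y = (a : ℂ) • y + (b : ℂ) • ψ y))

/-! ### `√2` and `√3` are cycle-induced under the lattice criteria (any Picard rank) -/

/-- **`√2` is cycle-induced on every marked projective K3 surface with `T(X)_ℚ ↪ (U³ ⊕ E₈(−2)) ⊗ ℚ`**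
(`≅ ⟨1,1,1⟩ ⊕ ⟨−1⟩¹¹`; isometric embedding `ι` of the transcendental coordinate vectors, injective
there): for `ψ` mapping `T(X)` to itself, rational and type-preserving there, with `ψ² = 2` and
multiplier `2` on `T(X)`, some algebraic class on `X ⊗ X` acts as `ψ` on `T(X)` — modulo
`Varesco2023_quotientSimilitude_two_of_transcendental_embedding` and `Buskin2019_hodgeIsometry_algebraic`.
[cite: Varesco2023, §2 (starting observation), Thm. 2.1 and Prop. 2.5] [cite: Buskin2019, Thm. 1.1] -/
theorem sqrtTwo_cycleInduced_of_embedding (hB : Buskin2019_hodgeIsometry_algebraic)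
    (hQ2 : Varesco2023_quotientSimilitude_two_of_transcendental_embedding) (hS : IsK3Surface S)
    (η : complexBetti S (2 * 1) ≃ₗ[ℂ] (K3Index → ℂ)) (p : complexBetti S (2 * 2)) (x : K3Index → ℂ)
    (hM : MarkedK3[S, η, p, x])
    (ι : (K3Index → ℚ) →ₗ[ℚ] (Fin 14 → ℚ))
    (hiso : ∀ v w : K3Index → ℚ, IsTranscendentalCoord S η v → IsTranscendentalCoord S η w →
      ∑ i : Fin 14, (![1, 1, 1, -1, -1, -1, -1, -1, -1, -1, -1, -1, -1, -1] : Fin 14 → ℚ) i * ι v i * ι w i =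
        k3FormRat v w)
    (hinj : ∀ v : K3Index → ℚ, IsTranscendentalCoord S η v → ι v = 0 → v = 0)
    (ψ : complexBetti S (2 * 1) →ₗ[ℂ] complexBetti S (2 * 1))
    (hψT : Set.MapsTo ψ (transcendentalSubspace S) (transcendentalSubspace S))
    (hψrat : ∀ y ∈ transcendentalSubspace S, IsRationalClass y → IsRationalClass (ψ y))
    (hψtyp : ∀ (i j : ℕ), ∀ y ∈ transcendentalSubspace S,
      IsOfHodgeType 2 S (2 * 1) i j y → IsOfHodgeType 2 S (2 * 1) i j (ψ y))
    (hψsq : ∀ y ∈ transcendentalSubspace S, ψ (ψ y) = (2 : ℂ) • y)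
    (hψmul : ∀ y ∈ transcendentalSubspace S, ∀ z ∈ transcendentalSubspace S,
      cupProduct (rfl : 2 * 1 + 2 * 1 = 2 * 2) (ψ y) (ψ z) =
        (2 : ℂ) • cupProduct (rfl : 2 * 1 + 2 * 1 = 2 * 2) y z) :
    ∃ γ ∈ algebraicClasses (S ⊗ S) 2, ∀ z ∈ transcendentalSubspace S,
      Corr[complexOrientationFamily, S, S, hS.1, hS.1 ; γ, z] = ψ z := by
  obtain ⟨hp₀, ⟨hpint, hpgen, hηint, hηcup, -, -⟩, -⟩ := id hM
  obtain ⟨Y, hY, ηY, pY, xY, hMY, φ, γ, hγalg, hφ, hφrat, hφtyp, hφT, hφonto, hφmul⟩ :=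
    hQ2 hS η p hp₀ hpint hpgen hηint hηcup ι hiso hinj
  refine cycleInduced_of_algebraicSimilitude hB hS η p x hM hY ηY pY xY hMY γ hγalg
    (fun y hy ↦ by rw [← hφ]; exact hφrat y hy) (fun i j y hy ↦ by rw [← hφ]; exact hφtyp i j y hy)
    (fun y hy ↦ by rw [← hφ]; exact hφT y hy)
    (fun z hz ↦ by
      obtain ⟨y, hy, hyz⟩ := hφonto z hz
      exact ⟨y, hy, by rw [← hφ]; exact hyz⟩)
    (m := 2) two_ne_zero (fun a ha b hb ↦ by rw [← hφ, ← hφ, Nat.cast_ofNat]; exact hφmul a ha b hb)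
    ψ hψT hψrat hψtyp (fun y hy ↦ by rw [Nat.cast_ofNat]; exact hψsq y hy)
    (fun y hy z hz ↦ by rw [Nat.cast_ofNat]; exact hψmul y hy z hz)

/-- **`√3` is cycle-induced on every marked projective K3 surface with `T(X)_ℚ ↪ (U³ ⊕ A₂²) ⊗ ℚ`**
(`≅ ⟨1,1,1,−1,−1,−1,−2,−6,−2,−6⟩`): for `ψ` mapping `T(X)` to itself, rational and type-preserving
there, with `ψ² = 3` and multiplier `3` on `T(X)`, some algebraic class on `X ⊗ X` acts as `ψ` on
`T(X)` — modulo `Varesco2023_quotientSimilitude_three_of_transcendental_embedding` and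
`Buskin2019_hodgeIsometry_algebraic`. [cite: Varesco2023, §2 (starting observation), Thm. 2.1 and Prop. 2.11]
[cite: Buskin2019, Thm. 1.1] -/
theorem sqrtThree_cycleInduced_of_embedding (hB : Buskin2019_hodgeIsometry_algebraic)
    (hQ3 : Varesco2023_quotientSimilitude_three_of_transcendental_embedding) (hS : IsK3Surface S)
    (η : complexBetti S (2 * 1) ≃ₗ[ℂ] (K3Index → ℂ)) (p : complexBetti S (2 * 2)) (x : K3Index → ℂ)
    (hM : MarkedK3[S, η, p, x])
    (ι : (K3Index → ℚ) →ₗ[ℚ] (Fin 10 → ℚ))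
    (hiso : ∀ v w : K3Index → ℚ, IsTranscendentalCoord S η v → IsTranscendentalCoord S η w →
      ∑ i : Fin 10, (![1, 1, 1, -1, -1, -1, -2, -6, -2, -6] : Fin 10 → ℚ) i * ι v i * ι w i =
        k3FormRat v w)
    (hinj : ∀ v : K3Index → ℚ, IsTranscendentalCoord S η v → ι v = 0 → v = 0)
    (ψ : complexBetti S (2 * 1) →ₗ[ℂ] complexBetti S (2 * 1))
    (hψT : Set.MapsTo ψ (transcendentalSubspace S) (transcendentalSubspace S))
    (hψrat : ∀ y ∈ transcendentalSubspace S, IsRationalClass y → IsRationalClass (ψ y))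
    (hψtyp : ∀ (i j : ℕ), ∀ y ∈ transcendentalSubspace S,
      IsOfHodgeType 2 S (2 * 1) i j y → IsOfHodgeType 2 S (2 * 1) i j (ψ y))
    (hψsq : ∀ y ∈ transcendentalSubspace S, ψ (ψ y) = (3 : ℂ) • y)
    (hψmul : ∀ y ∈ transcendentalSubspace S, ∀ z ∈ transcendentalSubspace S,
      cupProduct (rfl : 2 * 1 + 2 * 1 = 2 * 2) (ψ y) (ψ z) =
        (3 : ℂ) • cupProduct (rfl : 2 * 1 + 2 * 1 = 2 * 2) y z) :
    ∃ γ ∈ algebraicClasses (S ⊗ S) 2, ∀ z ∈ transcendentalSubspace S,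
      Corr[complexOrientationFamily, S, S, hS.1, hS.1 ; γ, z] = ψ z := by
  obtain ⟨hp₀, ⟨hpint, hpgen, hηint, hηcup, -, -⟩, -⟩ := id hM
  obtain ⟨Y, hY, ηY, pY, xY, hMY, φ, γ, hγalg, hφ, hφrat, hφtyp, hφT, hφonto, hφmul⟩ :=
    hQ3 hS η p hp₀ hpint hpgen hηint hηcup ι hiso hinj
  refine cycleInduced_of_algebraicSimilitude hB hS η p x hM hY ηY pY xY hMY γ hγalg
    (fun y hy ↦ by rw [← hφ]; exact hφrat y hy) (fun i j y hy ↦ by rw [← hφ]; exact hφtyp i j y hy)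
    (fun y hy ↦ by rw [← hφ]; exact hφT y hy)
    (fun z hz ↦ by
      obtain ⟨y, hy, hyz⟩ := hφonto z hz
      exact ⟨y, hy, by rw [← hφ]; exact hyz⟩)
    (m := 3) three_ne_zero (fun a ha b hb ↦ by rw [← hφ, ← hφ, Nat.cast_ofNat]; exact hφmul a ha b hb)
    ψ hψT hψrat hψtyp (fun y hy ↦ by rw [Nat.cast_ofNat]; exact hψsq y hy)
    (fun y hy z hz ↦ by rw [Nat.cast_ofNat]; exact hψmul y hy z hz)

/-! ### The lattice criteria are automatic at `ρ ≥ 11` (`p = 2`) and `ρ ≥ 15` (`p = 3`) -/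

/-- **`√2` is cycle-induced on every marked projective K3 surface of Picard rank `≥ 11`** (the embedding
`T(X)_ℚ ↪ ⟨1,1,1⟩ ⊕ ⟨−1⟩¹¹` is automatic in codimension `≥ 3`: Kitaoka, through the marking), modulo
`Varesco2023_quotientSimilitude_two_of_transcendental_embedding` and `Buskin2019_hodgeIsometry_algebraic`.
[cite: Varesco2023, Thm. 2.1, Prop. 2.5 and Thm. 2.9] [cite: Kitaoka1993, Ch. 4 Cor. 4.1.4] -/
theorem sqrtTwo_cycleInduced_of_eleven_le (hB : Buskin2019_hodgeIsometry_algebraic)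
    (hQ2 : Varesco2023_quotientSimilitude_two_of_transcendental_embedding) (hS : IsK3Surface S)
    (η : complexBetti S (2 * 1) ≃ₗ[ℂ] (K3Index → ℂ)) (p : complexBetti S (2 * 2)) (x : K3Index → ℂ)
    (hM : MarkedK3[S, η, p, x]) (hρ : 11 ≤ Module.finrank ℂ ↥(algebraicClasses S 1))
    (ψ : complexBetti S (2 * 1) →ₗ[ℂ] complexBetti S (2 * 1))
    (hψT : Set.MapsTo ψ (transcendentalSubspace S) (transcendentalSubspace S))
    (hψrat : ∀ y ∈ transcendentalSubspace S, IsRationalClass y → IsRationalClass (ψ y))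
    (hψtyp : ∀ (i j : ℕ), ∀ y ∈ transcendentalSubspace S,
      IsOfHodgeType 2 S (2 * 1) i j y → IsOfHodgeType 2 S (2 * 1) i j (ψ y))
    (hψsq : ∀ y ∈ transcendentalSubspace S, ψ (ψ y) = (2 : ℂ) • y)
    (hψmul : ∀ y ∈ transcendentalSubspace S, ∀ z ∈ transcendentalSubspace S,
      cupProduct (rfl : 2 * 1 + 2 * 1 = 2 * 2) (ψ y) (ψ z) =
        (2 : ℂ) • cupProduct (rfl : 2 * 1 + 2 * 1 = 2 * 2) y z) :
    ∃ γ ∈ algebraicClasses (S ⊗ S) 2, ∀ z ∈ transcendentalSubspace S,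
      Corr[complexOrientationFamily, S, S, hS.1, hS.1 ; γ, z] = ψ z := by
  obtain ⟨ι, hiso, hinj⟩ := NikulinIsogeny.exists_transcendentalEmbedding_weightedSumSquares hS η p x hM
    (![1, 1, 1, -1, -1, -1, -1, -1, -1, -1, -1, -1, -1, -1] : Fin 14 → ℚ) SqrtSix.u3e8Weights_ne_zero
    (by rw [SqrtSix.ncard_u3e8Weights_pos]) (by rw [SqrtSix.ncard_u3e8Weights_neg]; omega) (by omega)
  exact sqrtTwo_cycleInduced_of_embedding hB hQ2 hS η p x hM ι hiso hinj ψ hψT hψrat hψtyp hψsq hψmul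

/-- **`√3` is cycle-induced on every marked projective K3 surface of Picard rank `≥ 15`** (the embedding
`T(X)_ℚ ↪ ⟨1,1,1,−1,−1,−1,−2,−6,−2,−6⟩` is automatic at `dim T(X)_ℚ ≤ 7`), modulo
`Varesco2023_quotientSimilitude_three_of_transcendental_embedding` and `Buskin2019_hodgeIsometry_algebraic`.
[cite: Varesco2023, Thm. 2.1 and Prop. 2.11] [cite: Kitaoka1993, Ch. 4 Cor. 4.1.4] -/
theorem sqrtThree_cycleInduced_of_fifteen_le (hB : Buskin2019_hodgeIsometry_algebraic)
    (hQ3 : Varesco2023_quotientSimilitude_three_of_transcendental_embedding) (hS : IsK3Surface S)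
    (η : complexBetti S (2 * 1) ≃ₗ[ℂ] (K3Index → ℂ)) (p : complexBetti S (2 * 2)) (x : K3Index → ℂ)
    (hM : MarkedK3[S, η, p, x]) (hρ : 15 ≤ Module.finrank ℂ ↥(algebraicClasses S 1))
    (ψ : complexBetti S (2 * 1) →ₗ[ℂ] complexBetti S (2 * 1))
    (hψT : Set.MapsTo ψ (transcendentalSubspace S) (transcendentalSubspace S))
    (hψrat : ∀ y ∈ transcendentalSubspace S, IsRationalClass y → IsRationalClass (ψ y))
    (hψtyp : ∀ (i j : ℕ), ∀ y ∈ transcendentalSubspace S,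
      IsOfHodgeType 2 S (2 * 1) i j y → IsOfHodgeType 2 S (2 * 1) i j (ψ y))
    (hψsq : ∀ y ∈ transcendentalSubspace S, ψ (ψ y) = (3 : ℂ) • y)
    (hψmul : ∀ y ∈ transcendentalSubspace S, ∀ z ∈ transcendentalSubspace S,
      cupProduct (rfl : 2 * 1 + 2 * 1 = 2 * 2) (ψ y) (ψ z) =
        (3 : ℂ) • cupProduct (rfl : 2 * 1 + 2 * 1 = 2 * 2) y z) :
    ∃ γ ∈ algebraicClasses (S ⊗ S) 2, ∀ z ∈ transcendentalSubspace S,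
      Corr[complexOrientationFamily, S, S, hS.1, hS.1 ; γ, z] = ψ z := by
  obtain ⟨ι, hiso, hinj⟩ := NikulinIsogeny.exists_transcendentalEmbedding_weightedSumSquares hS η p x hM
    (![1, 1, 1, -1, -1, -1, -2, -6, -2, -6] : Fin 10 → ℚ) NikulinIsogeny.u3a2Weights_ne_zero
    (by rw [NikulinIsogeny.ncard_u3a2Weights_pos]) (by rw [NikulinIsogeny.ncard_u3a2Weights_neg]; omega)
    (by omega)
  exact sqrtThree_cycleInduced_of_embedding hB hQ3 hS η p x hM ι hiso hinj ψ hψT hψrat hψtyp hψsq hψmul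

/-! ### The Hodge conjecture for `S ⊗ S` in the two sectors -/

/-- **HC⁴(S ⊗ S) from the `√q`-sector data and a class acting as `ψ` on `T(S)`** (bookkeeping:
`SqrtSix.hodgeConjectureFor_square_of_corr_similitude` with `T₀ = [γ]_*`).
[cite: Varesco2023, §2 (p. 8)] [cite: Fulton1998, §16.1 Prop. 16.1.1] -/
theorem hodgeConjectureFor_square_of_corr_of_sector (hS : IsK3Surface S) {q : ℕ}
    (ψ : complexBetti S (2 * 1) →ₗ[ℂ] complexBetti S (2 * 1)) (hψ : SqrtSector[S, ψ, q])
    {γ : complexBetti (S ⊗ S) (2 * 2)} (hγalg : γ ∈ algebraicClasses (S ⊗ S) 2)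
    (hγ : ∀ z ∈ transcendentalSubspace S, Corr[complexOrientationFamily, S, S, hS.1, hS.1 ; γ, z] = ψ z) :
    HodgeConjectureFor 4 (S ⊗ S) :=
  SqrtSix.hodgeConjectureFor_square_of_corr_similitude hS ψ
    ((complexGysin complexOrientationFamily (IsSmoothProjective.tensor_holds hS.1 hS.1) hS.1
        (SemiCartesianMonoidalCategory.fst S S) (rfl : 2 * 1 + 2 * 2 + 2 * 2 = 2 * 1 + 2 * (2 + 2))) ∘ₗ
      ((cupProduct (rfl : 2 * 1 + 2 * 2 = 2 * 1 + 2 * 2)).flip γ) ∘ₗ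
      (complexBetti.map (SemiCartesianMonoidalCategory.snd S S) (2 * 1)).hom)
    γ hγalg (fun _ ↦ rfl) hγ hψ.2.2.2.2.2

/-- **HC⁴(S ⊗ S) for every marked projective K3 surface with `ρ(S) ≥ 11` in the `√2`-sector**
(`ψ` a Hodge similitude of `T(S)` of multiplier `2` with `End_Hdg(T(S)) ⊆ ℚ + ℚψ`), modulo
`Buskin2019_hodgeIsometry_algebraic` and `Varesco2023_quotientSimilitude_two_of_transcendental_embedding`
ONLY (compare `NikulinIsogeny.hodgeConjectureFor_square_of_eleven_le_of_sqrtTwo`: four named facts).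
[cite: Varesco2023, Thm. 2.1, Prop. 2.5 and Thm. 2.9] [cite: Kitaoka1993, Ch. 4 Cor. 4.1.4] -/
theorem hodgeConjectureFor_square_of_eleven_le_of_sqrtTwoSector (hB : Buskin2019_hodgeIsometry_algebraic)
    (hQ2 : Varesco2023_quotientSimilitude_two_of_transcendental_embedding) (hS : IsK3Surface S)
    (η : complexBetti S (2 * 1) ≃ₗ[ℂ] (K3Index → ℂ)) (p : complexBetti S (2 * 2)) (x : K3Index → ℂ)
    (hM : MarkedK3[S, η, p, x]) (hρ : 11 ≤ Module.finrank ℂ ↥(algebraicClasses S 1))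
    (ψ : complexBetti S (2 * 1) →ₗ[ℂ] complexBetti S (2 * 1)) (hψ : SqrtSector[S, ψ, 2]) :
    HodgeConjectureFor 4 (S ⊗ S) := by
  obtain ⟨hψT, hψrat, hψtyp, hψsq, hψmul, -⟩ := id hψ
  obtain ⟨γ, hγalg, hγ⟩ := sqrtTwo_cycleInduced_of_eleven_le hB hQ2 hS η p x hM hρ ψ hψT hψrat hψtyp
    (fun y hy ↦ by simpa using hψsq y hy) (fun y hy z hz ↦ by simpa using hψmul y hy z hz)
  exact hodgeConjectureFor_square_of_corr_of_sector hS ψ hψ hγalg hγ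

/-- **HC⁴(S ⊗ S) for every marked projective K3 surface with `ρ(S) ≥ 12` whose `H²` carries a rational
Hodge endomorphism `ψ` with `ψ² = 2` and multiplier `2` on `T(S)`** — EVERY projective K3 surface of
Picard rank `12, 14` or `16` with real multiplication by `ℚ(√2)` — modulo `Buskin2019_hodgeIsometry_algebraic`,
`Huybrechts_K3_marking_exists` (CM branch) and `Varesco2023_quotientSimilitude_two_of_transcendental_embedding`
ONLY (compare `NikulinIsogeny.hodgeConjectureFor_square_of_twelve_le_of_sqrtTwo`: five named facts). Proof:
sector clause automatic or CM (`sqrtSector_or_hasComplexMultiplication_of_natCast`, `q = 2`); CM by Buskin.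
[cite: Varesco2023, Thm. 2.1, Prop. 2.5, Rem. 2.10] [cite: Vangeemen2008, Lemma 3.2] [cite: Buskin2019, Thm. 1.1 and Corollary] -/
theorem hodgeConjectureFor_square_of_twelve_le_of_sqrtTwo (hB : Buskin2019_hodgeIsometry_algebraic)
    (hmark : Huybrechts_K3_marking_exists)
    (hQ2 : Varesco2023_quotientSimilitude_two_of_transcendental_embedding) (hS : IsK3Surface S)
    (η : complexBetti S (2 * 1) ≃ₗ[ℂ] (K3Index → ℂ)) (p : complexBetti S (2 * 2)) (x : K3Index → ℂ)
    (hM : MarkedK3[S, η, p, x]) (hρ : 12 ≤ Module.finrank ℂ ↥(algebraicClasses S 1))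
    (ψ : complexBetti S (2 * 1) →ₗ[ℂ] complexBetti S (2 * 1))
    (hψrat : ∀ y, IsRationalClass y → IsRationalClass (ψ y))
    (hψtyp : ∀ (i j : ℕ) y, IsOfHodgeType 2 S (2 * 1) i j y → IsOfHodgeType 2 S (2 * 1) i j (ψ y))
    (hψsq : ∀ y ∈ transcendentalSubspace S, ψ (ψ y) = (2 : ℂ) • y)
    (hψmul : ∀ y ∈ transcendentalSubspace S, ∀ z ∈ transcendentalSubspace S,
      cupProduct (rfl : 2 * 1 + 2 * 1 = 2 * 2) (ψ y) (ψ z) =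
        (2 : ℂ) • cupProduct (rfl : 2 * 1 + 2 * 1 = 2 * 2) y z) :
    HodgeConjectureFor 4 (S ⊗ S) := by
  have h2 : ¬ IsSquare (2 : ℕ) := by
    rintro ⟨r, hr⟩
    have hr2 : r < 2 := by nlinarith
    interval_cases r <;> omega
  rcases NikulinIsogeny.sqrtSector_or_hasComplexMultiplication_of_natCast h2 hS η p x hM hρ ψ hψrat hψtyp
      (fun y hy ↦ by simpa using hψsq y hy) (fun y hy z hz ↦ by simpa using hψmul y hy z hz) with hsec | hCM
  · exact hodgeConjectureFor_square_of_eleven_le_of_sqrtTwoSector hB hQ2 hS η p x hM (by omega) ψ hsec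
  · exact CMThird.hodgeConjectureFor_square_of_CM_of_buskin hB hmark S hS hCM

/-- **Marking-free form: every projective K3 surface of Picard rank `≥ 12` whose `H²` carries a rational
Hodge endomorphism `ψ` with `ψ² = 2` and multiplier `2` on `T(S)` (real multiplication by `√2`) satisfies
the Hodge conjecture for `S ⊗ S`**, modulo the three named facts `Buskin2019_hodgeIsometry_algebraic`,
`Huybrechts_K3_marking_exists`, `Varesco2023_quotientSimilitude_two_of_transcendental_embedding`.
[cite: Varesco2023, Thm. 2.1, Prop. 2.5, Rem. 2.10] [cite: Vangeemen2008, Lemma 3.2] -/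
theorem hodgeConjectureFor_square_of_twelve_le_of_sqrtTwo' (hB : Buskin2019_hodgeIsometry_algebraic)
    (hmark : Huybrechts_K3_marking_exists)
    (hQ2 : Varesco2023_quotientSimilitude_two_of_transcendental_embedding) (hS : IsK3Surface S)
    (hρ : 12 ≤ Module.finrank ℂ ↥(algebraicClasses S 1))
    (ψ : complexBetti S (2 * 1) →ₗ[ℂ] complexBetti S (2 * 1))
    (hψrat : ∀ y, IsRationalClass y → IsRationalClass (ψ y))
    (hψtyp : ∀ (i j : ℕ) y, IsOfHodgeType 2 S (2 * 1) i j y → IsOfHodgeType 2 S (2 * 1) i j (ψ y))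
    (hψsq : ∀ y ∈ transcendentalSubspace S, ψ (ψ y) = (2 : ℂ) • y)
    (hψmul : ∀ y ∈ transcendentalSubspace S, ∀ z ∈ transcendentalSubspace S,
      cupProduct (rfl : 2 * 1 + 2 * 1 = 2 * 2) (ψ y) (ψ z) =
        (2 : ℂ) • cupProduct (rfl : 2 * 1 + 2 * 1 = 2 * 2) y z) :
    HodgeConjectureFor 4 (S ⊗ S) := by
  obtain ⟨η, p, x, hM⟩ := hmark S hS
  exact hodgeConjectureFor_square_of_twelve_le_of_sqrtTwo hB hmark hQ2 hS η p x hM hρ ψ hψrat hψtyp hψsq hψmul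

/-- **HC⁴(S ⊗ S) for a marked projective K3 surface with `ρ(S) ≥ 12`, a `√3`-similitude `ψ`, and
`T(S)_ℚ ↪ (U³ ⊕ A₂²) ⊗ ℚ`** (Varesco's two-dimensional families at `ρ = 14`, Thm. 2.15 / Rem. 2.16:
all members), modulo `Buskin2019_hodgeIsometry_algebraic`, `Huybrechts_K3_marking_exists` (CM branch) and
`Varesco2023_quotientSimilitude_three_of_transcendental_embedding` ONLY (compare
`SymplecticLocus.hodgeConjectureFor_square_of_twelve_le_of_sqrtThree_of_embedding`, which consumes the
record `Varesco2023_sqrtThree_algebraic_of_transcendental_embedding` of the printed CONCLUSION instead).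
[cite: Varesco2023, Thm. 2.1, Prop. 2.11, Thm. 2.15 and Rem. 2.16] [cite: Vangeemen2008, Lemma 3.2] -/
theorem hodgeConjectureFor_square_of_twelve_le_of_sqrtThree_of_embedding
    (hB : Buskin2019_hodgeIsometry_algebraic) (hmark : Huybrechts_K3_marking_exists)
    (hQ3 : Varesco2023_quotientSimilitude_three_of_transcendental_embedding) (hS : IsK3Surface S)
    (η : complexBetti S (2 * 1) ≃ₗ[ℂ] (K3Index → ℂ)) (p : complexBetti S (2 * 2)) (x : K3Index → ℂ)
    (hM : MarkedK3[S, η, p, x]) (hρ : 12 ≤ Module.finrank ℂ ↥(algebraicClasses S 1))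
    (ι : (K3Index → ℚ) →ₗ[ℚ] (Fin 10 → ℚ))
    (hiso : ∀ v w : K3Index → ℚ, IsTranscendentalCoord S η v → IsTranscendentalCoord S η w →
      ∑ i : Fin 10, (![1, 1, 1, -1, -1, -1, -2, -6, -2, -6] : Fin 10 → ℚ) i * ι v i * ι w i =
        k3FormRat v w)
    (hinj : ∀ v : K3Index → ℚ, IsTranscendentalCoord S η v → ι v = 0 → v = 0)
    (ψ : complexBetti S (2 * 1) →ₗ[ℂ] complexBetti S (2 * 1))
    (hψrat : ∀ y, IsRationalClass y → IsRationalClass (ψ y))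
    (hψtyp : ∀ (i j : ℕ) y, IsOfHodgeType 2 S (2 * 1) i j y → IsOfHodgeType 2 S (2 * 1) i j (ψ y))
    (hψsq : ∀ y ∈ transcendentalSubspace S, ψ (ψ y) = (3 : ℂ) • y)
    (hψmul : ∀ y ∈ transcendentalSubspace S, ∀ z ∈ transcendentalSubspace S,
      cupProduct (rfl : 2 * 1 + 2 * 1 = 2 * 2) (ψ y) (ψ z) =
        (3 : ℂ) • cupProduct (rfl : 2 * 1 + 2 * 1 = 2 * 2) y z) :
    HodgeConjectureFor 4 (S ⊗ S) := by
  have h3 : ¬ IsSquare (3 : ℕ) := by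
    rintro ⟨r, hr⟩
    have hr2 : r < 2 := by nlinarith
    interval_cases r <;> omega
  rcases NikulinIsogeny.sqrtSector_or_hasComplexMultiplication_of_natCast h3 hS η p x hM hρ ψ hψrat hψtyp
      (fun y hy ↦ by simpa using hψsq y hy) (fun y hy z hz ↦ by simpa using hψmul y hy z hz) with hsec | hCM
  · obtain ⟨hψT, hψrat', hψtyp', -, -, -⟩ := id hsec
    obtain ⟨γ, hγalg, hγ⟩ := sqrtThree_cycleInduced_of_embedding hB hQ3 hS η p x hM ι hiso hinj ψ hψT
      hψrat' hψtyp' hψsq hψmul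
    exact hodgeConjectureFor_square_of_corr_of_sector hS ψ hsec hγalg hγ
  · exact CMThird.hodgeConjectureFor_square_of_CM_of_buskin hB hmark S hS hCM

/-- **HC⁴(S ⊗ S) for every marked projective K3 surface with `ρ(S) ≥ 15` whose `H²` carries a rational
Hodge endomorphism `ψ` with `ψ² = 3` and multiplier `3` on `T(S)`** — every projective K3 surface of
Picard rank `16` with real multiplication by `ℚ(√3)` — modulo `Buskin2019_hodgeIsometry_algebraic`,
`Huybrechts_K3_marking_exists` and `Varesco2023_quotientSimilitude_three_of_transcendental_embedding` ONLY.
[cite: Varesco2023, Thm. 2.1 and Prop. 2.11] [cite: Kitaoka1993, Ch. 4 Cor. 4.1.4] [cite: Vangeemen2008, Lemma 3.2] -/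
theorem hodgeConjectureFor_square_of_fifteen_le_of_sqrtThree (hB : Buskin2019_hodgeIsometry_algebraic)
    (hmark : Huybrechts_K3_marking_exists)
    (hQ3 : Varesco2023_quotientSimilitude_three_of_transcendental_embedding) (hS : IsK3Surface S)
    (η : complexBetti S (2 * 1) ≃ₗ[ℂ] (K3Index → ℂ)) (p : complexBetti S (2 * 2)) (x : K3Index → ℂ)
    (hM : MarkedK3[S, η, p, x]) (hρ : 15 ≤ Module.finrank ℂ ↥(algebraicClasses S 1))
    (ψ : complexBetti S (2 * 1) →ₗ[ℂ] complexBetti S (2 * 1))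
    (hψrat : ∀ y, IsRationalClass y → IsRationalClass (ψ y))
    (hψtyp : ∀ (i j : ℕ) y, IsOfHodgeType 2 S (2 * 1) i j y → IsOfHodgeType 2 S (2 * 1) i j (ψ y))
    (hψsq : ∀ y ∈ transcendentalSubspace S, ψ (ψ y) = (3 : ℂ) • y)
    (hψmul : ∀ y ∈ transcendentalSubspace S, ∀ z ∈ transcendentalSubspace S,
      cupProduct (rfl : 2 * 1 + 2 * 1 = 2 * 2) (ψ y) (ψ z) =
        (3 : ℂ) • cupProduct (rfl : 2 * 1 + 2 * 1 = 2 * 2) y z) :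
    HodgeConjectureFor 4 (S ⊗ S) := by
  obtain ⟨ι, hiso, hinj⟩ := NikulinIsogeny.exists_transcendentalEmbedding_weightedSumSquares hS η p x hM
    (![1, 1, 1, -1, -1, -1, -2, -6, -2, -6] : Fin 10 → ℚ) NikulinIsogeny.u3a2Weights_ne_zero
    (by rw [NikulinIsogeny.ncard_u3a2Weights_pos]) (by rw [NikulinIsogeny.ncard_u3a2Weights_neg]; omega)
    (by omega)
  exact hodgeConjectureFor_square_of_twelve_le_of_sqrtThree_of_embedding hB hmark hQ3 hS η p x hM (by omega)
    ι hiso hinj ψ hψrat hψtyp hψsq hψmul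

/-- **Marking-free form: every projective K3 surface of Picard rank `≥ 15` whose `H²` carries a rational
Hodge endomorphism `ψ` with `ψ² = 3` and multiplier `3` on `T(S)` (real multiplication by `√3`) satisfies
the Hodge conjecture for `S ⊗ S`**, modulo the three named facts `Buskin2019_hodgeIsometry_algebraic`,
`Huybrechts_K3_marking_exists`, `Varesco2023_quotientSimilitude_three_of_transcendental_embedding`.
[cite: Varesco2023, Thm. 2.1 and Prop. 2.11] [cite: Vangeemen2008, Lemma 3.2] -/
theorem hodgeConjectureFor_square_of_fifteen_le_of_sqrtThree' (hB : Buskin2019_hodgeIsometry_algebraic)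
    (hmark : Huybrechts_K3_marking_exists)
    (hQ3 : Varesco2023_quotientSimilitude_three_of_transcendental_embedding) (hS : IsK3Surface S)
    (hρ : 15 ≤ Module.finrank ℂ ↥(algebraicClasses S 1))
    (ψ : complexBetti S (2 * 1) →ₗ[ℂ] complexBetti S (2 * 1))
    (hψrat : ∀ y, IsRationalClass y → IsRationalClass (ψ y))
    (hψtyp : ∀ (i j : ℕ) y, IsOfHodgeType 2 S (2 * 1) i j y → IsOfHodgeType 2 S (2 * 1) i j (ψ y))
    (hψsq : ∀ y ∈ transcendentalSubspace S, ψ (ψ y) = (3 : ℂ) • y)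
    (hψmul : ∀ y ∈ transcendentalSubspace S, ∀ z ∈ transcendentalSubspace S,
      cupProduct (rfl : 2 * 1 + 2 * 1 = 2 * 2) (ψ y) (ψ z) =
        (3 : ℂ) • cupProduct (rfl : 2 * 1 + 2 * 1 = 2 * 2) y z) :
    HodgeConjectureFor 4 (S ⊗ S) := by
  obtain ⟨η, p, x, hM⟩ := hmark S hS
  exact hodgeConjectureFor_square_of_fifteen_le_of_sqrtThree hB hmark hQ3 hS η p x hM hρ ψ hψrat hψtyp
    hψsq hψmul

end Summit.HodgeConjecture.HodgeConjecture.Theorems.MarkmanPartnerTransport.QuotientSimilitude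

end
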